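import Summits.ValiantsHypothesis.ValiantsHypothesis.Theorems.KPlusLogSqLawOctaveCoarseEnvelope
import Summits.ValiantsHypothesis.ValiantsHypothesis.Theorems.KPlusLogSqLawOctaveLiveEnvelope
import Summits.ValiantsHypothesis.ValiantsHypothesis.Theorems.KPlusLogSqLawOctaveConjugation

/-!
# Route «KPlusLogSqLaw», octave line — TEMPERED LIFTING: roots sit near DESIGN breakpoints as soon as the design envelope is within `W` bits of the TRUE Newton top at the root scales (masking is priced by its DEPTH at root scales, never by the COUNT of masked vertices)

HONEST FRAMING.  Prover seat val-width-19561-oc1 (g3), `--supports stmt-ValiantsHypothesis-19561` (crux `WeakLifting`, OPEN), octave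
line of val-idea-6.  `OctaveWeakLifting` (Ω-W, stmt-ValiantsHypothesis-24457 of the DRAFT sibling route KPlusLogSqLawOctave), `WeakLifting`,
`TropicalB`, Conjecture B are OPEN; the candidate statements `DeadClassLifting`, `LiveBreaksBound`, `NewtonBreakLifting` (earlier files) are
DEFINED, NOT asserted, and nothing here asserts them.  Everything below is an unconditional theorem about ALL real pencils (symmetry unused) or a
definition; none of it proves any open item, and VP ≠ VNP is not moved.

WHAT THIS FILE PROVES (0 sorry; tools in `…OctaveCoarseEnvelope`).
* `TemperedAt d S W θ` (DEFINITION): at `θ` every present raw line is at most `W` above the true Newton top — the design envelope is never far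
  ABOVE the truth at `θ` (it is never more than `M` BELOW it: `exists_rawTerm_of_mem_support`).  `RootTempered d S W`: tempered at every root scale.
* `root_near_designBreaks_of_temperedAt` — THE TEMPERED CONFINEMENT: a nonzero real root at whose scale the pencil is `W`-tempered has
  `log₂|x|` within `2M + W + 1` of a DESIGN breakpoint (`M = m(⌊log₂(mK)⌋+1)`).  `temperedLifting_proof : TemperedLifting` — with
  `designPiecesBound_proof` and `cellCount_proof`: `TropRowD m K n ⇒` every root-tempered pencil has `Ω ≤ (2(2M+W+1)+3)(n+1)`.
* The earlier rungs are special cases up to the constant: `temperedAt_of_topDepthLE` (hence `…_of_depthLE`): `TopDepthLE Δ ⇒` tempered with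
  `W = Δ` at EVERY `θ`; `octaveCount_le_of_topDepthLE'`.
* DEAD CLASSES: `MaskDepthAt d S P θ` (DEFINITION: every present raw line at `θ` is within `P` of a LIVE raw line) and
  `temperedAt_of_liveDepthLE_of_maskDepthAt`: `LiveDepthLE Δ` + masking depth `≤ P` at `θ` ⇒ tempered with `W = Δ + P` at `θ`; hence
  `deadClassLifting_modMaskDepth`: dead-class lifting holds for every pencil whose masking DEPTH at its root scales is `≤ P`, with bound
  `(2(2M+Δ+P+1)+3)(n+1)` — the NUMBER of masked live vertices (`liveBreaks`, the object of `LiveBreaksBound`) never enters.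
* `octaveCount_le_of_rootTempered_conj`, `deadClassLifting_modMaskDepth_conj` — basis-free forms (via `octaveCount_pencilDet_conj`, p594442):
  it suffices that SOME conjugate `(G S_l H)_l` is root-tempered / live-shallow with shallow masking at root scales.

WHY (the masking question of g0/g2, `Cruxes/WeakLifting/Lines/octave-masking.md`).  The depth-free direction was typed as a COUNT
(`LiveBreaksBound`: live-envelope breakpoints `≤ n`), which is basis-dependent, sharp, and governed by hard convex geometry (EPRS configurations).
For octaves the count is the wrong currency: a root only needs ONE coarse integer-slope envelope with few breakpoints that is two-sided close to
the true tropicalization AT THE ROOT SCALE, and the design envelope (in any basis) is such an envelope exactly when the pocket under a reigning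
dead/deep class is shallow there.  What remains of the depth-free crux for this method is therefore a DEPTH statement — «masking depth at root
scales is `≤ 2^{C(K+log² m)}` in some basis» — a conditioning quantity, not a vertex count.  (Paper remark, not kernel: a dead reign over a
pocket of depth `≤ W` lasts at most `2(W+M)` in `θ`, so shallow pockets are also SHORT, and long dead reigns are deep.)  Nothing here claims
that depth bound; see the HONEST FRAMING.
-/

set_option linter.dupNamespace false
set_option autoImplicit false

namespace Summit.ValiantsHypothesis.ValiantsHypothesis.Theorems.KPlusLogSqLaw.Octave

open Polynomial Finset
open scoped BigOperators

/-! ### 1. Tempered pencils: roots sit near DESIGN breakpoints -/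

section Tempered

open Finset

variable {m K : ℕ}

/-- **`W`-tempered at `θ`** (DEFINITION of the seat): at the scale `θ`, every PRESENT raw line of the pencil lies at most `W` above the top
TRUE Newton line, i.e. below `log₂|coeff e| + e θ + W` for some exponent `e` of the support of `det`.  Equivalently: the archimedean design
envelope exceeds the true tropicalization by at most `W` at `θ`.  Dead or deep classes may reign at `θ`, provided the pocket under them is at
most `W` deep there. [definition of the seat] -/
def TemperedAt (d : Fin K → ℕ) (S : Fin K → Matrix (Fin m) (Fin m) ℝ) (W : ℕ) (θ : ℝ) : Prop :=
  ∀ τ : RawTerm m K, rawCoef S τ ≠ 0 →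
    ∃ e ∈ (pencilDet d S).support, rawLine d S τ θ ≤ newtonLog (pencilDet d S) e + e * θ + W

/-- **root-tempered** (DEFINITION): `W`-tempered at every root scale `θ = log₂|x|`, `x` a nonzero real root of `det`.  Nothing is asked away
from the roots (where dead reigns are harmless and, as `θ → ±∞`, often unavoidable in every basis). [definition of the seat] -/
def RootTempered (d : Fin K → ℕ) (S : Fin K → Matrix (Fin m) (Fin m) ℝ) (W : ℕ) : Prop :=
  ∀ x : ℝ, x ≠ 0 → (pencilDet d S).IsRoot x → TemperedAt d S W (Real.logb 2 |x|)

/-- **TEMPERED CONFINEMENT** (the theorem of this file).  If the pencil is `W`-tempered at the scale of a nonzero real root `x` of its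
(nonzero) determinant, then `log₂|x|` lies within `2M + W + 1` of a DESIGN breakpoint, `M = m(⌊log₂(mK)⌋+1)`: the root forces a near-tie
(`≤ M`) of the true Newton lines (`exists_newton_nearTie`), the design lines are a coarse family at most `M` below (`exists_rawTerm_of_mem_support`)
and at most `W` above (temperedness) the truth, and `coarseEnvelopeGap` applies.  No depth hypothesis, no liveness hypothesis, no count of
masked vertices. [folklore] -/
theorem root_near_designBreaks_of_temperedAt (W : ℕ) (d : Fin K → ℕ) (S : Fin K → Matrix (Fin m) (Fin m) ℝ) (x : ℝ)
    (hx0 : x ≠ 0) (hf0 : pencilDet d S ≠ 0) (hroot : (pencilDet d S).IsRoot x) (hW : TemperedAt d S W (Real.logb 2 |x|)) :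
    ∃ b ∈ designBreaks d S, |Real.logb 2 |x| - b| ≤ ((2 * (m * (Nat.log 2 (m * K) + 1)) + W + 1 : ℕ) : ℝ) := by
  classical
  set f := pencilDet d S with hf
  -- the near-tie of the true Newton lines
  obtain ⟨e₀, he₀, e₁, he₁, hne, htop0, hnear0⟩ := exists_newton_nearTie f x hx0 hf0 hroot
  set θ := Real.logb 2 |x| with hθ
  let ι := {e : ℕ // e ∈ f.support}
  let κ := {τ : RawTerm m K // rawCoef S τ ≠ 0}
  -- the top present raw line at θ
  obtain ⟨τe, hτe, -, -⟩ := exists_rawTerm_of_mem_support d S he₀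
  obtain ⟨g₀, -, hg₀max⟩ := Finset.exists_max_image (univ : Finset κ) (fun g => rawLine d S g.1 θ) ⟨⟨τe, hτe⟩, mem_univ _⟩
  -- temperedness at θ: the top raw line is within W of the top Newton line
  obtain ⟨e', he', hbelow'⟩ := hW g₀.1 g₀.2
  have hbelow : rawLine d S g₀.1 θ ≤ newtonLog f e₀ + e₀ * θ + W := by
    have := htop0 e' he'
    rw [hf] at this ⊢
    linarith
  set N := Fintype.card (RawTerm m K) with hN
  have hNpos : 0 < N := Fintype.card_pos_iff.2 ⟨τe⟩
  -- apply the coarse envelope gap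
  obtain ⟨b, hb, g, g', hgg', htie, hall⟩ := coarseEnvelopeGap (ι := ι) (κ := κ)
    (fun e => ((e.1 : ℕ) : ℤ)) (fun e => newtonLog f e.1) (fun g => ((rawSlope d g.1 : ℕ) : ℤ)) (fun g => rawLog S g.1)
    (Real.logb 2 N) W (Real.logb 2 f.support.card) θ ⟨e₀, he₀⟩ ⟨e₁, he₁⟩ g₀
    (by intro h; apply hne; have h' : ((e₀ : ℕ) : ℤ) = ((e₁ : ℕ) : ℤ) := h; exact_mod_cast h')
    (fun l => by have h := htop0 l.1 l.2; push_cast; linarith)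
    (by push_cast; linarith)
    (fun g => by have h := hg₀max g (mem_univ _); simp only [rawLine] at h; push_cast; linarith)
    (by simp only [rawLine] at hbelow; push_cast; linarith)
    (fun φ l => by
      obtain ⟨τ, hτ, hslope, hle⟩ := exists_rawTerm_of_mem_support d S l.2
      refine ⟨⟨τ, hτ⟩, ?_⟩
      have hs : ((rawSlope d τ : ℕ) : ℝ) = (l.1 : ℝ) := by exact_mod_cast hslope
      push_cast
      rw [hs]
      linarith)
  -- identify b as the design breakpoint of (g, g')
  have hgg'' : (rawSlope d g.1 : ℝ) ≠ rawSlope d g'.1 := by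
    intro h; apply hgg'; exact_mod_cast (show rawSlope d g.1 = rawSlope d g'.1 by exact_mod_cast h)
  have hbcross : rawCross d S (g.1, g'.1) = b := by
    rw [rawCross]
    have htie' : rawLog S g.1 + (rawSlope d g.1 : ℝ) * b = rawLog S g'.1 + (rawSlope d g'.1 : ℝ) * b := by
      simpa [Int.cast_natCast] using htie
    rw [div_eq_iff (sub_ne_zero.2 (Ne.symm hgg''))]
    linarith
  refine ⟨b, ?_, ?_⟩
  · rw [designBreaks, Finset.mem_image]
    refine ⟨(g.1, g'.1), ?_, hbcross⟩
    rw [Finset.mem_filter]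
    refine ⟨mem_univ _, g.2, g'.2, fun h => hgg' (by exact_mod_cast h), fun t ht => ?_⟩
    rw [hbcross]
    have := hall ⟨t, ht⟩
    simpa [Int.cast_natCast] using this
  · have h1 : Real.logb 2 N ≤ ((m * (Nat.log 2 (m * K) + 1) : ℕ) : ℝ) := logb_card_rawTerm_le m K hNpos
    have h2 : Real.logb 2 f.support.card ≤ ((m * (Nat.log 2 (m * K) + 1) : ℕ) : ℝ) :=
      logb_card_support_le d S (Finset.card_pos.2 ⟨e₀, he₀⟩)
    calc |θ - b| ≤ Real.logb 2 N + W + Real.logb 2 f.support.card + 1 := hb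
      _ ≤ ((2 * (m * (Nat.log 2 (m * K) + 1)) + W + 1 : ℕ) : ℝ) := by push_cast at h1 h2 ⊢; linarith

/-- **tempered lifting** (statement; PROVED below as `temperedLifting_proof`): if the unsigned tropical row of format `(m, K)` is `≤ n`
(`TropRowD m K n`), every ROOT-TEMPERED real pencil of that format (temperedness `W` at its root scales; symmetry not needed) has its nonzero
real roots in at most `(2(2M + W + 1) + 3)(n + 1)` dyadic octaves.  `ShallowOctaveLifting` / `DominatedClassLifting` are the cases
`DepthLE`/`TopDepthLE Δ` (`temperedAt_of_topDepthLE`, `W = Δ`); dead classes are allowed as long as the pockets under their reigns are shallow AT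
THE ROOT SCALES (`temperedAt_of_liveDepthLE_of_maskDepthAt`). NOT the crux: Ω-W is the statement with no temperedness hypothesis.
[definition of the seat] -/
def TemperedLifting : Prop :=
  ∀ (m K n W : ℕ), Summit.ValiantsHypothesis.ValiantsHypothesis.Theorems.KPlusLogSqLaw.TropRowD m K n →
    ∀ (d : Fin K → ℕ) (S : Fin K → Matrix (Fin m) (Fin m) ℝ), RootTempered d S W →
      octaveCount (pencilDet d S) ≤ (2 * (2 * (m * (Nat.log 2 (m * K) + 1)) + W + 1) + 3) * (n + 1)

/-- octaves of a root-tempered pencil against its design breakpoints (no tropical hypothesis yet). [folklore] -/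
theorem octaveCount_le_designBreaks_of_rootTempered (W : ℕ) (d : Fin K → ℕ) (S : Fin K → Matrix (Fin m) (Fin m) ℝ)
    (hW : RootTempered d S W) :
    octaveCount (pencilDet d S) ≤ (2 * (2 * (m * (Nat.log 2 (m * K) + 1)) + W + 1) + 2) * (designBreaks d S).card :=
  cellCount_proof (pencilDet d S) (designBreaks d S) (2 * (m * (Nat.log 2 (m * K) + 1)) + W + 1)
    fun x hx hp hr => root_near_designBreaks_of_temperedAt W d S x hx hp hr (hW x hx hr)

/-- **tempered lifting, PROVED** (composition with `designPiecesBound_proof` and `cellCount_proof`). [folklore] -/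
theorem temperedLifting_proof : TemperedLifting := by
  intro m K n W hT d S hW
  have hB : (designBreaks d S).card ≤ n := designPiecesBound_proof m K n hT d S
  calc octaveCount (pencilDet d S)
      ≤ (2 * (2 * (m * (Nat.log 2 (m * K) + 1)) + W + 1) + 2) * (designBreaks d S).card :=
        octaveCount_le_designBreaks_of_rootTempered W d S hW
    _ ≤ (2 * (2 * (m * (Nat.log 2 (m * K) + 1)) + W + 1) + 2) * n := Nat.mul_le_mul_left _ hB
    _ ≤ (2 * (2 * (m * (Nat.log 2 (m * K) + 1)) + W + 1) + 3) * (n + 1) := Nat.mul_le_mul (Nat.le_succ _) (Nat.le_succ _)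

end Tempered

/-! ### 2. The earlier rungs are tempered; dead classes modulo masking DEPTH; basis-freeness -/

section Corollaries

open Finset

variable {m K : ℕ}

/-- a present raw term of class `e` whose class is shallow certifies `e ∈ support` with `log₂|coeff e| ≥ log₂|rawCoef τ| − Δ`. [folklore] -/
theorem newtonLog_ge_of_classMass_le {d : Fin K → ℕ} {S : Fin K → Matrix (Fin m) (Fin m) ℝ} {Δ : ℕ} {τ : RawTerm m K}
    (hτ : rawCoef S τ ≠ 0)
    (hdepth : classMass d S (rawSlope d τ) ≤ (2 : ℝ) ^ Δ * |(pencilDet d S).coeff (rawSlope d τ)|) :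
    rawSlope d τ ∈ (pencilDet d S).support ∧ rawLog S τ ≤ newtonLog (pencilDet d S) (rawSlope d τ) + Δ := by
  classical
  have hmass : |rawCoef S τ| ≤ classMass d S (rawSlope d τ) := by
    rw [classMass]
    exact Finset.single_le_sum (f := fun τ' => |rawCoef S τ'|) (fun τ' _ => abs_nonneg _) (by simp)
  have hτpos : 0 < |rawCoef S τ| := abs_pos.2 hτ
  have h2pos : (0 : ℝ) < (2 : ℝ) ^ Δ := by positivity
  have hcpos : 0 < |(pencilDet d S).coeff (rawSlope d τ)| := by
    by_contra h
    push Not at h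
    have : (2 : ℝ) ^ Δ * |(pencilDet d S).coeff (rawSlope d τ)| ≤ 0 := by nlinarith [abs_nonneg ((pencilDet d S).coeff (rawSlope d τ))]
    linarith
  refine ⟨Polynomial.mem_support_iff.2 (abs_pos.1 hcpos), ?_⟩
  have h1 := Real.logb_le_logb_of_le (b := 2) (by norm_num) hτpos (hmass.trans hdepth)
  rw [Real.logb_mul h2pos.ne' hcpos.ne', Real.logb_pow, Real.logb_self_eq_one (by norm_num), mul_one] at h1
  rw [rawLog, newtonLog]
  linarith

/-- **top-shallow pencils are tempered everywhere**: under `TopDepthLE Δ` the pencil is `Δ`-tempered at every `θ` (the top raw term at `θ`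
belongs to a top class, whose coefficient is within `Δ` bits of its mass).  Hence `DominatedClassLifting` and the rung `ShallowOctaveLifting`
are instances of `TemperedLifting` (with `2M + Δ + 1` for `M + Δ`). [folklore] -/
theorem temperedAt_of_topDepthLE {d : Fin K → ℕ} {S : Fin K → Matrix (Fin m) (Fin m) ℝ} {Δ : ℕ} (hΔ : TopDepthLE d S Δ) (θ : ℝ) :
    TemperedAt d S Δ θ := by
  classical
  intro τ hτ
  obtain ⟨τs, hτs, hmax⟩ := Finset.exists_max_image (univ.filter (fun τ' : RawTerm m K => rawCoef S τ' ≠ 0))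
    (fun τ' => rawLine d S τ' θ) ⟨τ, by simp [hτ]⟩
  have hτs' : rawCoef S τs ≠ 0 := (mem_filter.1 hτs).2
  have htopc : IsTopClass d S (rawSlope d τs) :=
    ⟨θ, τs, hτs', rfl, fun τ' hτ' => hmax τ' (by simp [hτ'])⟩
  obtain ⟨hsupp, hlog⟩ := newtonLog_ge_of_classMass_le hτs' (hΔ _ htopc)
  refine ⟨rawSlope d τs, hsupp, ?_⟩
  have h1 : rawLine d S τ θ ≤ rawLine d S τs θ := hmax τ (by simp [hτ])
  rw [rawLine] at h1 ⊢
  rw [rawLine] at h1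
  linarith

/-- shallow pencils (`DepthLE Δ`, the rung's hypothesis) are `Δ`-tempered everywhere. [folklore] -/
theorem temperedAt_of_depthLE {d : Fin K → ℕ} {S : Fin K → Matrix (Fin m) (Fin m) ℝ} {Δ : ℕ} (hΔ : DepthLE d S Δ) (θ : ℝ) :
    TemperedAt d S Δ θ :=
  temperedAt_of_topDepthLE (topDepthLE_of_depthLE hΔ) θ

/-- top-shallow pencils are root-tempered. [folklore] -/
theorem rootTempered_of_topDepthLE {d : Fin K → ℕ} {S : Fin K → Matrix (Fin m) (Fin m) ℝ} {Δ : ℕ} (hΔ : TopDepthLE d S Δ) :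
    RootTempered d S Δ := fun _ _ _ => temperedAt_of_topDepthLE hΔ _

/-- the dominated-class rung recovered from tempered lifting (weaker constant `2M + Δ + 1`; the sharper `M + Δ` is
`dominatedClassLifting_proof`). [folklore] -/
theorem octaveCount_le_of_topDepthLE' (m K n Δ : ℕ)
    (hT : Summit.ValiantsHypothesis.ValiantsHypothesis.Theorems.KPlusLogSqLaw.TropRowD m K n)
    (d : Fin K → ℕ) (S : Fin K → Matrix (Fin m) (Fin m) ℝ) (hΔ : TopDepthLE d S Δ) :
    octaveCount (pencilDet d S) ≤ (2 * (2 * (m * (Nat.log 2 (m * K) + 1)) + Δ + 1) + 3) * (n + 1) :=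
  temperedLifting_proof m K n Δ hT d S (rootTempered_of_topDepthLE hΔ)

/-- **masking depth ≤ P at θ** (DEFINITION of the seat): every present raw line at `θ` is within `P` of a LIVE raw line at `θ` (a raw term
that is present AND whose slope class has a nonzero coefficient).  The pocket of the live envelope under a reigning dead class is at most `P`
deep at `θ`; how many live vertices the pocket has is irrelevant. [definition of the seat] -/
def MaskDepthAt (d : Fin K → ℕ) (S : Fin K → Matrix (Fin m) (Fin m) ℝ) (P : ℕ) (θ : ℝ) : Prop :=
  ∀ τ : RawTerm m K, rawCoef S τ ≠ 0 → ∃ τ' : RawTerm m K, IsLiveTerm d S τ' ∧ rawLine d S τ θ ≤ rawLine d S τ' θ + P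

/-- masking depth `≤ P` at every root scale. [definition of the seat] -/
def RootMaskDepthLE (d : Fin K → ℕ) (S : Fin K → Matrix (Fin m) (Fin m) ℝ) (P : ℕ) : Prop :=
  ∀ x : ℝ, x ≠ 0 → (pencilDet d S).IsRoot x → MaskDepthAt d S P (Real.logb 2 |x|)

/-- **live-shallow + shallow masking ⇒ tempered**: `LiveDepthLE Δ` and masking depth `≤ P` at `θ` give `(Δ + P)`-temperedness at `θ`.
[folklore] -/
theorem temperedAt_of_liveDepthLE_of_maskDepthAt {d : Fin K → ℕ} {S : Fin K → Matrix (Fin m) (Fin m) ℝ} {Δ P : ℕ} {θ : ℝ}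
    (hΔ : LiveDepthLE d S Δ) (hP : MaskDepthAt d S P θ) : TemperedAt d S (Δ + P) θ := by
  intro τ hτ
  obtain ⟨τ', ⟨hτ'p, hτ'c⟩, hle⟩ := hP τ hτ
  obtain ⟨hsupp, hlog⟩ := newtonLog_ge_of_classMass_le hτ'p (hΔ _ hτ'c)
  refine ⟨rawSlope d τ', hsupp, ?_⟩
  rw [rawLine] at hle ⊢
  rw [rawLine] at hle
  push_cast
  linarith

/-- under a depth-`0` everywhere-live pencil nothing is asked: `DepthLE` ⇒ masking depth `0` (every present term is live). [folklore] -/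
theorem maskDepthAt_of_depthLE {d : Fin K → ℕ} {S : Fin K → Matrix (Fin m) (Fin m) ℝ} {Δ : ℕ} (hΔ : DepthLE d S Δ) (θ : ℝ) :
    MaskDepthAt d S 0 θ := by
  intro τ hτ
  have hlive := liveDepthLE_of_depthLE hΔ
  have hdepth : classMass d S (rawSlope d τ) ≤ (2 : ℝ) ^ Δ * |(pencilDet d S).coeff (rawSlope d τ)| := by
    rw [classMass_eq]; exact hΔ _
  obtain ⟨hsupp, -⟩ := newtonLog_ge_of_classMass_le hτ hdepth
  exact ⟨τ, ⟨hτ, Polynomial.mem_support_iff.1 hsupp⟩, by push_cast; linarith⟩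

/-- **DEAD-CLASS LIFTING MODULO MASKING DEPTH** (PROVED): if the unsigned tropical row of format `(m, K)` is `≤ n`, every real pencil with
live depth `≤ Δ` whose masking depth at its ROOT SCALES is `≤ P` has its nonzero real roots in at most `(2(2M + Δ + P + 1) + 3)(n + 1)`
octaves.  Compare `DeadClassLifting` (DEFINED, NOT asserted, `…OctaveDominatedClasses`): the same with no masking hypothesis.  What separates
them is ONLY the depth of the live pocket under a dead reign at a root scale — not `LiveBreaksBound`, not the number of live-envelope
breakpoints. [folklore] -/
theorem deadClassLifting_modMaskDepth (m K n Δ P : ℕ)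
    (hT : Summit.ValiantsHypothesis.ValiantsHypothesis.Theorems.KPlusLogSqLaw.TropRowD m K n)
    (d : Fin K → ℕ) (S : Fin K → Matrix (Fin m) (Fin m) ℝ) (hΔ : LiveDepthLE d S Δ) (hP : RootMaskDepthLE d S P) :
    octaveCount (pencilDet d S) ≤ (2 * (2 * (m * (Nat.log 2 (m * K) + 1)) + (Δ + P) + 1) + 3) * (n + 1) :=
  temperedLifting_proof m K n (Δ + P) hT d S fun x hx hr => temperedAt_of_liveDepthLE_of_maskDepthAt hΔ (hP x hx hr)

/-- **basis-free tempered lifting** (PROVED, via `octaveCount_pencilDet_conj`): it suffices that SOME conjugate `(G S_l H)_l` is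
root-tempered — roots and octaves do not see the bases; raw terms, design envelopes, dead reigns and pockets do. [folklore] -/
theorem octaveCount_le_of_rootTempered_conj (m K n W : ℕ)
    (hT : Summit.ValiantsHypothesis.ValiantsHypothesis.Theorems.KPlusLogSqLaw.TropRowD m K n)
    (d : Fin K → ℕ) (S : Fin K → Matrix (Fin m) (Fin m) ℝ) (G H : Matrix (Fin m) (Fin m) ℝ)
    (hG : G.det ≠ 0) (hH : H.det ≠ 0) (hW : RootTempered d (fun l => G * S l * H) W) :
    octaveCount (pencilDet d S) ≤ (2 * (2 * (m * (Nat.log 2 (m * K) + 1)) + W + 1) + 3) * (n + 1) := by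
  rw [← octaveCount_pencilDet_conj G H hG hH d S]
  exact temperedLifting_proof m K n W hT d _ hW

/-- basis-free dead-class lifting modulo masking depth. [folklore] -/
theorem deadClassLifting_modMaskDepth_conj (m K n Δ P : ℕ)
    (hT : Summit.ValiantsHypothesis.ValiantsHypothesis.Theorems.KPlusLogSqLaw.TropRowD m K n)
    (d : Fin K → ℕ) (S : Fin K → Matrix (Fin m) (Fin m) ℝ) (G H : Matrix (Fin m) (Fin m) ℝ)
    (hG : G.det ≠ 0) (hH : H.det ≠ 0) (hΔ : LiveDepthLE d (fun l => G * S l * H) Δ)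
    (hP : RootMaskDepthLE d (fun l => G * S l * H) P) :
    octaveCount (pencilDet d S) ≤ (2 * (2 * (m * (Nat.log 2 (m * K) + 1)) + (Δ + P) + 1) + 3) * (n + 1) := by
  rw [← octaveCount_pencilDet_conj G H hG hH d S]
  exact deadClassLifting_modMaskDepth m K n Δ P hT d _ hΔ hP

end Corollaries

end Summit.ValiantsHypothesis.ValiantsHypothesis.Theorems.KPlusLogSqLaw.Octave
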